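import Mathlib
import Literature.Computability.Complexity.CliqueTestGraphs
import Literature.Computability.Complexity.Rossman2008CliqueProofs

/-!
# PneNP / ConvexRankGates — `ConvexGateBlind`: restricted factorisations ARE negative covers (converse direction)

Helpers (`--supports stmt-PneNP-10680`). Companion of `…NegCover.lean`. A non-negative factorisation of the shifted
clique-distance matrix `D - εJ` is RESTRICTED when its `Q`-side factors are clique sums of edge weightings,
`a_l(Q) = t_l(E(Q)) = ∑_{e ⊆ Q} t_l(e)` (i.e. lie in the column space of `D`, spanned by the pair indicators `[e ⊆ Q]`);
every factorisation of size `#E = rank D` is of this kind, as is the trivial one. This file proves that such a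
factorisation, for ANY `ε > 0`, already is a negative cover by the same weightings `t_l` (`negCover_of_restrictedFactorisation`):
`∑_l (b_l(u)/ε') t_l = -1` on the edges of every clique-free `u` and `= (1-ε')/ε'` elsewhere, `ε' = ε/C(k,2)`. Together with
`cliqueDist_sub_factorisation_of_negCover` this makes the restricted ε-sensitive class ε-FREE: it is non-empty for some
`ε > 0` iff a negative cover exists (sizes `R ↦ R`, `s ↦ s + #E`).

The one non-formal ingredient is the injectivity of the `k`-set/pair inclusion map for `2 ≤ k ≤ m - 2`
(`eq_zero_of_cliqueSum_eq_zero`: if every `k`-set has clique sum `0` then the weighting is `0`), proved here by the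
erase-averaging identity `∑_{v∈S} t(E(S∖v)) = (#S - 2)·t(E(S))` (so vanishing climbs from size `k` to every size `≥ k`)
and inclusion–exclusion over `univ, univ∖x, univ∖y, univ∖{x,y}`, which isolates `t(xy)`. [folklore]
-/

namespace Summit.PneNP.PneNP.Theorems

open Finset Literature.Computability.Complexity

/-! ### Clique vectors of erased sets and of `univ` -/

/-- `cliqueVec` unfolded: the edge has both endpoints in `S`. [folklore] -/
theorem cliqueVec_eq_true_iff_forall_mem {m : ℕ} (S : Finset (Fin m)) (e : (⊤ : SimpleGraph (Fin m)).edgeSet) :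
    cliqueVec S e = true ↔ ∀ v ∈ (e : Sym2 (Fin m)), v ∈ S := by
  simp [cliqueVec]

/-- Every edge is switched on by the clique vector of the whole vertex set. [folklore] -/
theorem cliqueVec_univ_eq_true {m : ℕ} (e : (⊤ : SimpleGraph (Fin m)).edgeSet) :
    cliqueVec (Finset.univ : Finset (Fin m)) e = true := by
  rw [cliqueVec_eq_true_iff_forall_mem]
  exact fun v _ => Finset.mem_univ v

/-- Erasing a vertex keeps exactly the edges of `S` that avoid it. [folklore] -/
theorem cliqueVec_erase_eq_true_iff {m : ℕ} (S : Finset (Fin m)) (v : Fin m) (e : (⊤ : SimpleGraph (Fin m)).edgeSet) :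
    cliqueVec (S.erase v) e = true ↔ cliqueVec S e = true ∧ v ∉ (e : Sym2 (Fin m)) := by
  rw [cliqueVec_eq_true_iff_forall_mem, cliqueVec_eq_true_iff_forall_mem]
  constructor
  · intro h
    refine ⟨fun w hw => Finset.mem_of_mem_erase (h w hw), fun hv => ?_⟩
    exact Finset.notMem_erase v S (h v hv)
  · rintro ⟨h, hv⟩ w hw
    exact Finset.mem_erase.2 ⟨fun hwv => hv (hwv ▸ hw), h w hw⟩

/-- An edge of `K_m` with both endpoints in `S` meets `S` in exactly two vertices (real-valued count of the
vertices of `S` OFF the edge). [folklore] -/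
theorem sum_ite_notMem_edge {m : ℕ} (S : Finset (Fin m)) (e : (⊤ : SimpleGraph (Fin m)).edgeSet)
    (he : cliqueVec S e = true) :
    ∑ v ∈ S, (if v ∉ (e : Sym2 (Fin m)) then (1 : ℝ) else 0) = (S.card : ℝ) - 2 := by
  classical
  obtain ⟨e, hemem⟩ := e
  induction e using Sym2.ind with
  | h x y =>
    have hxy : x ≠ y := by
      rw [SimpleGraph.mem_edgeSet] at hemem
      exact hemem.ne
    rw [cliqueVec_eq_true_iff_forall_mem] at he
    have hx : x ∈ S := he x (Sym2.mem_mk_left x y)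
    have hy : y ∈ S := he y (Sym2.mem_mk_right x y)
    have hsplit : ∀ v ∈ S, (if v ∉ (s(x, y) : Sym2 (Fin m)) then (1 : ℝ) else 0) =
        1 - ((if v = x then (1 : ℝ) else 0) + (if v = y then (1 : ℝ) else 0)) := by
      intro v _
      by_cases hvx : v = x
      · subst hvx
        simp [hxy]
      · by_cases hvy : v = y
        · subst hvy
          simp [hvx]
        · simp [Sym2.mem_iff, hvx, hvy]
    rw [Finset.sum_congr rfl hsplit, Finset.sum_sub_distrib, Finset.sum_add_distrib]
    simp only [Finset.sum_const, nsmul_eq_mul, mul_one, Finset.sum_ite_eq', if_pos hx, if_pos hy]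
    ring

/-! ### Clique sums: the erase-averaging identity and upward vanishing -/

/-- **Erase-averaging.** `∑_{v ∈ S} t(E(S ∖ v)) = (#S - 2) · t(E(S))`: every edge of `S` survives the erasure of
exactly `#S - 2` vertices. [folklore] -/
theorem sum_erase_cliqueSum {m : ℕ} (S : Finset (Fin m)) (t : (⊤ : SimpleGraph (Fin m)).edgeSet → ℝ) :
    ∑ v ∈ S, (∑ e, if cliqueVec (S.erase v) e = true then t e else 0) =
      ((S.card : ℝ) - 2) * ∑ e, (if cliqueVec S e = true then t e else 0) := by
  classical
  rw [Finset.sum_comm, Finset.mul_sum]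
  refine Finset.sum_congr rfl fun e _ => ?_
  by_cases he : cliqueVec S e = true
  · have hrw : ∀ v ∈ S, (if cliqueVec (S.erase v) e = true then t e else 0) =
        t e * (if v ∉ (e : Sym2 (Fin m)) then (1 : ℝ) else 0) := by
      intro v _
      by_cases hv : v ∉ (e : Sym2 (Fin m))
      · rw [if_pos ((cliqueVec_erase_eq_true_iff S v e).2 ⟨he, hv⟩), if_pos hv, mul_one]
      · have : ¬ cliqueVec (S.erase v) e = true := fun h => hv ((cliqueVec_erase_eq_true_iff S v e).1 h).2
        rw [if_neg this, if_neg hv, mul_zero]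
    rw [Finset.sum_congr rfl hrw, ← Finset.mul_sum, sum_ite_notMem_edge S e he, if_pos he]
    ring
  · have hrw : ∀ v ∈ S, (if cliqueVec (S.erase v) e = true then t e else 0) = 0 := by
      intro v _
      have : ¬ cliqueVec (S.erase v) e = true := fun h => he ((cliqueVec_erase_eq_true_iff S v e).1 h).1
      rw [if_neg this]
    rw [Finset.sum_congr rfl hrw, Finset.sum_const_zero, if_neg he, mul_zero]

/-- **Upward vanishing.** If the clique sums of `t` vanish on every `k`-set (`2 ≤ k`), they vanish on every set
of size `≥ k`. [folklore] -/
theorem cliqueSum_eq_zero_of_le_card {m k : ℕ} (hk : 2 ≤ k) (t : (⊤ : SimpleGraph (Fin m)).edgeSet → ℝ)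
    (h0 : ∀ Q : Finset (Fin m), Q.card = k → ∑ e, (if cliqueVec Q e = true then t e else 0) = 0) :
    ∀ S : Finset (Fin m), k ≤ S.card → ∑ e, (if cliqueVec S e = true then t e else 0) = 0 := by
  classical
  -- induction on the excess `S.card - k`
  suffices h : ∀ n : ℕ, ∀ S : Finset (Fin m), S.card = k + n → ∑ e, (if cliqueVec S e = true then t e else 0) = 0 by
    intro S hS
    exact h (S.card - k) S (by omega)
  intro n
  induction n with
  | zero => intro S hS; exact h0 S (by simpa using hS)
  | succ n ih =>
    intro S hS
    have hsum := sum_erase_cliqueSum S t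
    have hzero : ∑ v ∈ S, (∑ e, if cliqueVec (S.erase v) e = true then t e else 0) = 0 := by
      refine Finset.sum_eq_zero fun v hv => ih (S.erase v) ?_
      rw [Finset.card_erase_of_mem hv, hS]
      omega
    rw [hzero] at hsum
    have hpos : ((S.card : ℝ) - 2) ≠ 0 := by
      have : (k : ℝ) + (n + 1) = S.card := by exact_mod_cast hS.symm
      have hk' : (2 : ℝ) ≤ k := by exact_mod_cast hk
      intro hz
      linarith
    exact (mul_eq_zero.1 hsum.symm).resolve_left hpos

/-- **Injectivity of the `k`-set/pair inclusion map** (`2 ≤ k ≤ m - 2`): an edge weighting all of whose `k`-set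
clique sums vanish is zero. (Inclusion–exclusion over `univ, univ ∖ x, univ ∖ y, univ ∖ {x,y}` isolates `t(xy)`.)
[folklore; Gottlieb 1966 / Kantor 1972 in general form] -/
theorem eq_zero_of_cliqueSum_eq_zero {m k : ℕ} (hk : 2 ≤ k) (hkm : k + 2 ≤ m)
    (t : (⊤ : SimpleGraph (Fin m)).edgeSet → ℝ)
    (h0 : ∀ Q : Finset (Fin m), Q.card = k → ∑ e, (if cliqueVec Q e = true then t e else 0) = 0) :
    t = 0 := by
  classical
  have hall := cliqueSum_eq_zero_of_le_card hk t h0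
  funext e₀
  obtain ⟨e₀, he₀⟩ := e₀
  induction e₀ using Sym2.ind with
  | h x y =>
    have hxy : x ≠ y := by
      rw [SimpleGraph.mem_edgeSet] at he₀
      exact he₀.ne
    set U : Finset (Fin m) := Finset.univ with hU
    have hcardU : U.card = m := by rw [hU, Finset.card_univ, Fintype.card_fin]
    have hUx : (U.erase x).card = m - 1 := by rw [Finset.card_erase_of_mem (Finset.mem_univ _), hcardU]
    have hUy : (U.erase y).card = m - 1 := by rw [Finset.card_erase_of_mem (Finset.mem_univ _), hcardU]
    have hyUx : y ∈ U.erase x := Finset.mem_erase.2 ⟨hxy.symm, Finset.mem_univ _⟩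
    have hUxy : ((U.erase x).erase y).card = m - 2 := by rw [Finset.card_erase_of_mem hyUx, hUx]; omega
    have h1 := hall U (by rw [hcardU]; omega)
    have h2 := hall (U.erase x) (by rw [hUx]; omega)
    have h3 := hall (U.erase y) (by rw [hUy]; omega)
    have h4 := hall ((U.erase x).erase y) (by rw [hUxy]; omega)
    -- inclusion–exclusion, edge by edge
    have hie : ∀ e : (⊤ : SimpleGraph (Fin m)).edgeSet,
        (if cliqueVec U e = true then t e else 0) - (if cliqueVec (U.erase x) e = true then t e else 0)
          - (if cliqueVec (U.erase y) e = true then t e else 0)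
          + (if cliqueVec ((U.erase x).erase y) e = true then t e else 0) =
        if (e : Sym2 (Fin m)) = s(x, y) then t e else 0 := by
      intro e
      have hUe : cliqueVec U e = true := cliqueVec_univ_eq_true e
      have hxe : cliqueVec (U.erase x) e = true ↔ x ∉ (e : Sym2 (Fin m)) := by
        rw [cliqueVec_erase_eq_true_iff]; exact ⟨fun h => h.2, fun h => ⟨hUe, h⟩⟩
      have hye : cliqueVec (U.erase y) e = true ↔ y ∉ (e : Sym2 (Fin m)) := by
        rw [cliqueVec_erase_eq_true_iff]; exact ⟨fun h => h.2, fun h => ⟨hUe, h⟩⟩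
      have hxye : cliqueVec ((U.erase x).erase y) e = true ↔ x ∉ (e : Sym2 (Fin m)) ∧ y ∉ (e : Sym2 (Fin m)) := by
        rw [cliqueVec_erase_eq_true_iff, hxe]
      have hmm : (x ∈ (e : Sym2 (Fin m)) ∧ y ∈ (e : Sym2 (Fin m))) ↔ (e : Sym2 (Fin m)) = s(x, y) :=
        Sym2.mem_and_mem_iff hxy
      rw [if_pos hUe]
      by_cases hx : x ∈ (e : Sym2 (Fin m)) <;> by_cases hy : y ∈ (e : Sym2 (Fin m))
      · rw [if_neg (fun h => (hxe.1 h) hx), if_neg (fun h => (hye.1 h) hy), if_neg (fun h => (hxye.1 h).1 hx),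
          if_pos (hmm.1 ⟨hx, hy⟩)]
        ring
      · rw [if_neg (fun h => (hxe.1 h) hx), if_pos (hye.2 hy), if_neg (fun h => (hxye.1 h).1 hx),
          if_neg (fun h => hy (hmm.2 h).2)]
        ring
      · rw [if_pos (hxe.2 hx), if_neg (fun h => (hye.1 h) hy), if_neg (fun h => (hxye.1 h).2 hy),
          if_neg (fun h => hx (hmm.2 h).1)]
        ring
      · rw [if_pos (hxe.2 hx), if_pos (hye.2 hy), if_pos (hxye.2 ⟨hx, hy⟩), if_neg (fun h => hx (hmm.2 h).1)]
        ring
    have hcomb : (∑ e, (if cliqueVec U e = true then t e else 0)) - (∑ e, (if cliqueVec (U.erase x) e = true then t e else 0))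
        - (∑ e, (if cliqueVec (U.erase y) e = true then t e else 0))
        + (∑ e, (if cliqueVec ((U.erase x).erase y) e = true then t e else 0)) =
        ∑ e : (⊤ : SimpleGraph (Fin m)).edgeSet, (if (e : Sym2 (Fin m)) = s(x, y) then t e else 0) := by
      rw [← Finset.sum_sub_distrib, ← Finset.sum_sub_distrib, ← Finset.sum_add_distrib]
      exact Finset.sum_congr rfl fun e _ => hie e
    rw [h1, h2, h3, h4] at hcomb
    have hpick : ∑ e : (⊤ : SimpleGraph (Fin m)).edgeSet, (if (e : Sym2 (Fin m)) = s(x, y) then t e else 0) =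
        t ⟨s(x, y), he₀⟩ := by
      have hrw : ∀ e ∈ (Finset.univ : Finset (⊤ : SimpleGraph (Fin m)).edgeSet),
          (if (e : Sym2 (Fin m)) = s(x, y) then t e else 0) =
            if (⟨s(x, y), he₀⟩ : (⊤ : SimpleGraph (Fin m)).edgeSet) = e then t e else 0 := by
        intro e _
        by_cases h : (e : Sym2 (Fin m)) = s(x, y)
        · rw [if_pos h, if_pos (Subtype.ext h.symm)]
        · rw [if_neg h, if_neg (fun h' => h (by rw [← h']))]
      rw [Finset.sum_congr rfl hrw, Finset.sum_ite_eq]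
      simp
    rw [hpick] at hcomb
    simp only [sub_self, add_zero] at hcomb
    simp only [Pi.zero_apply]
    linarith

/-! ### Restricted factorisations are negative covers -/

/-- **A restricted factorisation of `D - εJ` is a negative cover.** Suppose `2 ≤ k ≤ m - 2`, `ε > 0`, `b ≥ 0`, and
`D[Q,u] - ε = ∑_l b_l(u)·t_l(E(Q))` for all `k`-sets `Q` and all `k`-clique-free `u` (non-negativity of the clique sums
`t_l(E(Q))`, the other half of "restricted", is not even needed here). Then with `ε' = ε/C(k,2)`, `μ_l(u) = b_l(u)/ε'` and `Λ = max 0 ((1-ε')/ε')`, the conic combination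
`∑_l μ_l(u) t_l` equals `-1` on every edge of `u` and `(1-ε')/ε' ≤ Λ` on every edge — the hypotheses of
`cliqueDist_sub_factorisation_of_negCover`. (Proof: `∑_l b_l(u) t_l - 𝟙_{E∖u} + ε'𝟙` has all `k`-set clique sums zero,
hence vanishes by injectivity.) [folklore] -/
theorem negCover_of_restrictedFactorisation : ∀ {m k R : ℕ}, 2 ≤ k → k + 2 ≤ m →
    ∀ (t : Fin R → (⊤ : SimpleGraph (Fin m)).edgeSet → ℝ)
      (b : ((⊤ : SimpleGraph (Fin m)).edgeSet → Bool) → Fin R → ℝ), (∀ u l, 0 ≤ b u l) →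
    ∀ (ε : ℝ), 0 < ε →
    (∀ (Q : Finset (Fin m)) (u : (⊤ : SimpleGraph (Fin m)).edgeSet → Bool), Q.card = k → cliqueFn m k u = false →
      (∑ e, if cliqueVec Q e = true ∧ u e = false then (1 : ℝ) else 0) - ε =
        ∑ l, b u l * ∑ e, (if cliqueVec Q e = true then t l e else 0)) →
    ∃ (μ : ((⊤ : SimpleGraph (Fin m)).edgeSet → Bool) → Fin R → ℝ) (Λ : ℝ),
      (∀ u l, 0 ≤ μ u l) ∧ 0 ≤ Λ ∧
      (∀ u, cliqueFn m k u = false → ∀ e, u e = true → ∑ l, μ u l * t l e ≤ -1) ∧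
      (∀ u, cliqueFn m k u = false → ∀ e, ∑ l, μ u l * t l e ≤ Λ) := by
  intro m k R hk hkm t b hb ε hε hfact
  classical
  have hC : (0 : ℝ) < k.choose 2 := by exact_mod_cast Nat.choose_pos hk
  set ε' : ℝ := ε / k.choose 2 with hε'
  have hε'pos : 0 < ε' := div_pos hε hC
  -- the exact identity `∑_l b_l(u) t_l = 𝟙_{E∖u} - ε'𝟙` on every edge, for clique-free `u`
  have hid : ∀ u, cliqueFn m k u = false → ∀ e, ∑ l, b u l * t l e = (if u e = true then 0 else 1) - ε' := by
    intro u hu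
    -- the difference weighting has vanishing clique sums on `k`-sets
    set w : (⊤ : SimpleGraph (Fin m)).edgeSet → ℝ := fun e => ∑ l, b u l * t l e - ((if u e = true then 0 else 1) - ε') with hw
    have hw0 : ∀ Q : Finset (Fin m), Q.card = k → ∑ e, (if cliqueVec Q e = true then w e else 0) = 0 := by
      intro Q hQ
      have hf := hfact Q u hQ hu
      have hcount : ∑ e : (⊤ : SimpleGraph (Fin m)).edgeSet, (if cliqueVec Q e = true then (1 : ℝ) else 0) = k.choose 2 := by
        rw [Finset.sum_boole, Literature.Computability.Complexity.card_filter_cliqueVec Q, hQ]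
      -- rewrite both sides of `hf` as single sums over edges
      have hR : ∑ l, b u l * ∑ e, (if cliqueVec Q e = true then t l e else 0) =
          ∑ e, (if cliqueVec Q e = true then ∑ l, b u l * t l e else 0) := by
        simp only [Finset.mul_sum]
        rw [Finset.sum_comm]
        refine Finset.sum_congr rfl fun e _ => ?_
        by_cases hc : cliqueVec Q e = true
        · simp only [if_pos hc]
        · simp only [if_neg hc, mul_zero, Finset.sum_const_zero]
      have hL : (∑ e, if cliqueVec Q e = true ∧ u e = false then (1 : ℝ) else 0) - ε =
          ∑ e : (⊤ : SimpleGraph (Fin m)).edgeSet, (if cliqueVec Q e = true then (if u e = true then 0 else 1) - ε' else 0) := by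
        have hεe : ε = ε' * k.choose 2 := by rw [hε']; field_simp
        rw [hεe, ← hcount, Finset.mul_sum, ← Finset.sum_sub_distrib]
        refine Finset.sum_congr rfl fun e _ => ?_
        by_cases hc : cliqueVec Q e = true <;> by_cases hue : u e = true <;> simp [hc, hue]
      rw [hR, hL] at hf
      have : ∑ e, (if cliqueVec Q e = true then w e else 0) =
          ∑ e, (if cliqueVec Q e = true then ∑ l, b u l * t l e else 0) -
            ∑ e : (⊤ : SimpleGraph (Fin m)).edgeSet, (if cliqueVec Q e = true then (if u e = true then 0 else 1) - ε' else 0) := by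
        rw [← Finset.sum_sub_distrib]
        refine Finset.sum_congr rfl fun e _ => ?_
        by_cases hc : cliqueVec Q e = true
        · simp only [if_pos hc, hw]
        · simp only [if_neg hc, sub_zero]
      rw [this, hf, sub_self]
    have hwz := eq_zero_of_cliqueSum_eq_zero hk hkm w hw0
    intro e
    have := congrFun hwz e
    simp only [hw, Pi.zero_apply] at this
    linarith
  refine ⟨fun u l => b u l / ε', max 0 ((1 - ε') / ε'), fun u l => div_nonneg (hb u l) hε'pos.le, le_max_left _ _, ?_, ?_⟩
  · intro u hu e hue
    have h := hid u hu e
    rw [if_pos hue] at h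
    have hsum : ∑ l, b u l / ε' * t l e = (∑ l, b u l * t l e) / ε' := by
      rw [Finset.sum_div]
      exact Finset.sum_congr rfl fun l _ => by ring
    rw [hsum, h, div_le_iff₀ hε'pos]
    linarith
  · intro u hu e
    have h := hid u hu e
    have hsum : ∑ l, b u l / ε' * t l e = (∑ l, b u l * t l e) / ε' := by
      rw [Finset.sum_div]
      exact Finset.sum_congr rfl fun l _ => by ring
    rw [hsum, h]
    refine le_trans ?_ (le_max_right _ _)
    rw [div_le_div_iff_of_pos_right hε'pos]
    split_ifs <;> linarith

end Summit.PneNP.PneNP.Theorems
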